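import Literature.MathematicalPhysics.QuantumFieldTheory.Balaban1983to89.B1Eq324BenfattoKernelRegression
import Literature.MathematicalPhysics.QuantumFieldTheory.Balaban1983to89.B1Eq324BenfattoCondKernelGeneric
import HarnessLib

/-!
# `Balaban1983to89.B1Eq324BenfattoKernelCondTranslation` — [BenfattoEtAl1978] p. 152 «P̂₀(dz|(z̄_Δ)_{Δ∈C})» / §5 p. 159 «a new
# pavement displaced by b²/2» FOR A GENERAL COVARIANCE KERNEL: the regression dictionary and the conditioned field of ANY kernel are
# COVARIANT under every injective re-indexing of the lattice `Q₀` — translations in particular —, PROVED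

statement-level skeleton of published theorems with citation tags; proofs where landed; nothing here is a claim about the
Yang–Mills mass gap

WHY THIS MODULE (cell `pub-ymgap`, seat `dag-n08-c` gen 22; node N08 [Balaban1985UV3]; the [BenfattoEtAl1978] source chain behind the
(α)-row `h324`).  §5 of [BenfattoEtAl1978] iterates its corridor construction over DISPLACED pavements (p. 159: *"we can proceed as
before choosing a new pavement Q′_b displaced by b²/2 with respect to Q_b"*); «as before» is the translation invariance of the free
field (1.1).  In the tree the transport exists for the free field only: `…Translation.P0_map_translate` (the field) and
`…CondTranslation.condField_map_translate` (the CONDITIONED field `P̄ = P̂₀(·|z̄_C)` of p. 152, under which the upper bound (4.6),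
`C ≠ ∅`, is integrated).  The kernel census of the Basic Lemma (`pub-ymgap-dag-n08-c/N08-BASICLEMMA-KERNEL-CENSUS.md` §3.4 / §5 (T))
records that for a general — not translation-invariant — covariance the chain must instead CARRY the shifted kernel `K(· + s, · + s)`,
and that this costs no hypothesis on the class: the push-forward of the Gaussian field of `K` under a re-indexing `e` of `Q₀` is the
Gaussian field of `K(e·, e·)` (`…CondKernelGeneric.gaussianFieldOfKernel_map_reindex`, the unconditioned level).  This file is the
CONDITIONED level, for the conditioned field of a general kernel in the currency of `…KernelRegression` / `…KernelCondField`
(seat dag-n08-d): `P̄^K_{C,z̄} := (gaussianFieldOfKernel (condCov K C)).map (ζ ↦ condMean K C z̄ + ζ)` — no new definition; at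
`K = freeCov d α β` this expression is `B1Eq324BenfattoLemma.condField d α β C z̄` by `rfl`.

THE PRINTED STATEMENTS (p. 152, p. 159; cf. the headers of `…B1Eq324BenfattoLemma`, `…CondTranslation`): *"P̄(dz) is obtained by
considering the z_Δ's, Δ ∈ Q₀, as random variables with the conditional distribution P̂₀(dz|(z̄_Δ)_{Δ∈C})"* (p. 152); *"we can proceed as
before choosing a new pavement Q′_b displaced by b²/2 … Again one proceeds as before by choosing a third pavement Q″_b displaced by
b²/4"* (p. 159).

WHAT IS PROVED (standard axioms; no `sorry`; no definition).  `K : Q₀ → Q₀ → ℝ` any kernel, `e : Q₀ → Q₀` injective,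
`K′ := K(e·, e·)`, `C ⊂ Q₀` finite, `C′ := e(C) = C.image e`.
* §1 THE DICTIONARY (pure linear algebra, NO invertibility hypothesis — Mathlib's `Matrix.inv_submatrix_equiv` holds for the junk inverse
  too): `det_covGram_reindex` (`det K′_CC = det K_{C′C′}`), `isUnit_det_covGram_reindex_iff`, `inv_covGram_reindex_apply`,
  ★ `condCov_reindex` (`C′^{K′,C}(x, y) = C^{K,C′}(e x, e y)`), ★ `condMean_reindex` (`u^{K′}_C(w ∘ e)(x) = u^K_{C′}(w)(e x)`),
  `condMean_reindex_congr` (any datum agreeing with `w ∘ e` on `C`).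
* §2 THE CONDITIONED FIELD: ★★ `condFieldK_map_reindex` — for `K` positive semidefinite with `K_{C′C′}` invertible,
  `(P̄^K_{C′,w}).map (z ↦ z ∘ e) = P̄^{K′}_{C, w∘e}` (push-forward of the Schur-complement field by `…CondKernelGeneric.gaussianFieldOfKernel_map_reindex`,
  positive semidefiniteness of `C^{K,C′}` by `…KernelRegression.isPosSemidefKernel_condCov`, then §1); ★ `integral_condFieldK_comp_reindex`
  (`∫ F(z ∘ e) dP̄^K_{C′,w} = ∫ F dP̄^{K′}_{C,w∘e}` for measurable `F`).
* §3 TRANSLATIONS `e = (· + s)`: `condCov_translate`, `condMean_translate`, ★★ `condFieldK_map_translate`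
  (`(P̄^K_{C+s,w}).map (z ↦ z(· + s)) = P̄^{K(·+s,·+s)}_{C, w(·+s)}`), ★ `integral_condFieldK_comp_translate`; and for a
  translation-INVARIANT kernel (`K(x + s, y + s) = K(x, y)`): `det_covGram_image_add_of_invariant`, ★ `condFieldK_map_translate_of_invariant`,
  ★ `integral_condFieldK_comp_translate_of_invariant` — the statement shape of the free-field theorems
  `…CondTranslation.condField_map_translate` / `integral_condField_comp_translate` for EVERY translation-invariant positive-semidefinite
  kernel with invertible Gram matrix on `C` (at `K = freeCov d α β` those free-field theorems are recovered modulo `rfl` on `condField` and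
  `…AppendixC2.isUnit_det_covGram_freeCov`; they are not restated here).

HONEST SCOPE.  Transport lemmas only (Gaussian regression algebra and a push-forward); the class HYPOTHESES of a generalised Basic Lemma
and that lemma are NOT stated or proved here; nothing of the §5 chain is ported; nothing of [Balaban1985UV3] / [Balaban1985UV2] is
asserted; count-neutral for N08; nothing about d = 4, the continuum, OS axioms, a mass gap or the Clay problem.
-/

noncomputable section

open Finset Matrix MeasureTheory ProbabilityTheory
open scoped BigOperators Matrix

namespace Literature.MathematicalPhysics.QuantumFieldTheory.Balaban1983to89.B1Eq324BenfattoKernelCondTranslation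

open Literature.MathematicalPhysics.QuantumFieldTheory
open Literature.MathematicalPhysics.QuantumFieldTheory.Balaban1983to89.B1Eq324BenfattoLemma
open Literature.MathematicalPhysics.QuantumFieldTheory.Balaban1983to89.B1Eq324BenfattoKernelRegression
open Literature.MathematicalPhysics.QuantumFieldTheory.Balaban1983to89.B1Eq324BenfattoCondKernelGeneric

variable {d : ℕ}

/-! ## §1  The regression dictionary under an injective re-indexing of `Q₀` -/

section Dictionary

variable (K : B1Eq324BenfattoLemma.Site d → B1Eq324BenfattoLemma.Site d → ℝ) {e : B1Eq324BenfattoLemma.Site d → B1Eq324BenfattoLemma.Site d}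

/-- kernel: the canonical map `C → e(C)`, `c ↦ e c`, is a bijection for injective `e`. [folklore] -/
private theorem bijective_toImage (he : Function.Injective e) (C : Finset (B1Eq324BenfattoLemma.Site d)) :
    Function.Bijective
      (fun c : C => (⟨e c, Finset.mem_image_of_mem e c.2⟩ : (C.image e : Finset (B1Eq324BenfattoLemma.Site d)))) := by
  refine ⟨fun a b hab => Subtype.ext (he ?_), fun i => ?_⟩
  · exact congrArg Subtype.val hab
  · obtain ⟨c, hc, hce⟩ := Finset.mem_image.1 i.2
    exact ⟨⟨c, hc⟩, Subtype.ext hce⟩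

/-- kernel: the Gram matrix of `K′ = K(e·, e·)` on `C` is the Gram matrix of `K` on `e(C)` re-indexed along `c ↦ e c`. [folklore] -/
private theorem covGram_reindex_eq_submatrix (he : Function.Injective e) (C : Finset (B1Eq324BenfattoLemma.Site d)) :
    covGram (fun x y => K (e x) (e y)) C =
      (covGram K (C.image e)).submatrix (Equiv.ofBijective _ (bijective_toImage he C))
        (Equiv.ofBijective _ (bijective_toImage he C)) := by
  ext i j
  rfl

/-- **`det K′_CC = det K_{e(C)e(C)}`** — the Gram determinant of the re-indexed kernel `K′ = K(e·, e·)` on `C` is the Gram determinant of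
`K` on `e(C)`. [cite: BenfattoEtAl1978, (1.1) p.144, Appendix C (C.6) p.164] -/
theorem det_covGram_reindex (he : Function.Injective e) (C : Finset (B1Eq324BenfattoLemma.Site d)) :
    (covGram (fun x y => K (e x) (e y)) C).det = (covGram K (C.image e)).det := by
  rw [covGram_reindex_eq_submatrix K he C]
  exact Matrix.det_submatrix_equiv_self _ _

/-- `K′_CC` is invertible iff `K_{e(C)e(C)}` is. [cite: BenfattoEtAl1978, Appendix C (C.6) p.164] -/
theorem isUnit_det_covGram_reindex_iff (he : Function.Injective e) (C : Finset (B1Eq324BenfattoLemma.Site d)) :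
    IsUnit (covGram (fun x y => K (e x) (e y)) C).det ↔ IsUnit (covGram K (C.image e)).det := by
  rw [det_covGram_reindex K he C]

/-- **The inverse Gram matrix re-indexes entrywise**: `(K′_CC)⁻¹_{cc′} = (K_{e(C)e(C)})⁻¹_{e c, e c′}` (no invertibility needed: Mathlib's
`Matrix.inv_submatrix_equiv` holds for the generalised inverse as well). [cite: BenfattoEtAl1978, Appendix C (C.6)–(C.7) p.164] -/
theorem inv_covGram_reindex_apply (he : Function.Injective e) (C : Finset (B1Eq324BenfattoLemma.Site d)) (c c' : C) :
    (covGram (fun x y => K (e x) (e y)) C)⁻¹ c c' =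
      (covGram K (C.image e))⁻¹ ⟨e c, Finset.mem_image_of_mem e c.2⟩ ⟨e c', Finset.mem_image_of_mem e c'.2⟩ := by
  rw [covGram_reindex_eq_submatrix K he C, Matrix.inv_submatrix_equiv]
  rfl

/-- **THE CONDITIONAL COVARIANCE RE-INDEXES** — «the covariance with Dirichlet boundary condition» of the re-indexed kernel `K′ = K(e·, e·)`
on `C` is that of `K` on `e(C)`, read through `e`: `C^{K′,C}(x, y) = C^{K,e(C)}(e x, e y)` for all `x, y ∈ Q₀` (any kernel, any injective `e`;
no invertibility hypothesis). [cite: BenfattoEtAl1978, Appendix C 2) (C.6) p.164; §5 p.159] -/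
theorem condCov_reindex (he : Function.Injective e) (C : Finset (B1Eq324BenfattoLemma.Site d)) (x y : B1Eq324BenfattoLemma.Site d) :
    condCov (fun x y => K (e x) (e y)) C x y = condCov K (C.image e) (e x) (e y) := by
  simp only [condCov]
  congr 1
  refine Fintype.sum_equiv (Equiv.ofBijective _ (bijective_toImage he C)) _ _ fun c => ?_
  refine Fintype.sum_equiv (Equiv.ofBijective _ (bijective_toImage he C)) _ _ fun c' => ?_
  rw [inv_covGram_reindex_apply K he C c c']
  rfl

/-- **THE REGRESSION MEAN RE-INDEXES** — the «center u_Δ» of the re-indexed kernel on `C` with datum `w ∘ e` is the centre of `K` on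
`e(C)` with datum `w`, read through `e`: `u^{K′}_C(w ∘ e)(x) = u^K_{e(C)}(w)(e x)` (any kernel, any injective `e`).
[cite: BenfattoEtAl1978, Appendix C 2) (C.7) p.164; §5 p.159] -/
theorem condMean_reindex (he : Function.Injective e) (C : Finset (B1Eq324BenfattoLemma.Site d)) (w : B1Eq324BenfattoLemma.Site d → ℝ)
    (x : B1Eq324BenfattoLemma.Site d) :
    condMean (fun x y => K (e x) (e y)) C (fun c => w (e c)) x = condMean K (C.image e) w (e x) := by
  simp only [condMean]
  refine Fintype.sum_equiv (Equiv.ofBijective _ (bijective_toImage he C)) _ _ fun c => ?_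
  refine Fintype.sum_equiv (Equiv.ofBijective _ (bijective_toImage he C)) _ _ fun c' => ?_
  rw [inv_covGram_reindex_apply K he C c c']
  rfl

/-- The same with ANY datum `v` agreeing with `w ∘ e` on `C` (only the values on the conditioning set enter the regression mean).
[cite: BenfattoEtAl1978, p.152 «P̂₀(dz|(z̄_Δ)_{Δ∈C})»] -/
theorem condMean_reindex_congr (he : Function.Injective e) (C : Finset (B1Eq324BenfattoLemma.Site d)) {w v : B1Eq324BenfattoLemma.Site d → ℝ}
    (hv : ∀ c ∈ C, v c = w (e c)) (x : B1Eq324BenfattoLemma.Site d) :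
    condMean (fun x y => K (e x) (e y)) C v x = condMean K (C.image e) w (e x) := by
  rw [← condMean_reindex K he C w x]
  exact condMean_congr (fun x y => K (e x) (e y)) C hv x

end Dictionary

/-! ## §2  The conditioned field of a general kernel under an injective re-indexing of `Q₀` -/

section Field

variable (K : B1Eq324BenfattoLemma.Site d → B1Eq324BenfattoLemma.Site d → ℝ) {e : B1Eq324BenfattoLemma.Site d → B1Eq324BenfattoLemma.Site d}

/-- kernel: re-indexing of configurations `z ↦ z ∘ e` is measurable. [folklore] -/
private theorem measurable_reindex (e : B1Eq324BenfattoLemma.Site d → B1Eq324BenfattoLemma.Site d) :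
    Measurable fun (z : B1Eq324BenfattoLemma.Site d → ℝ) (x : B1Eq324BenfattoLemma.Site d) => z (e x) :=
  measurable_pi_lambda _ fun x => measurable_pi_apply (e x)

/-- kernel: the shift `ζ ↦ u + ζ` by a fixed configuration is measurable. [folklore] -/
private theorem measurable_shift (u : B1Eq324BenfattoLemma.Site d → ℝ) :
    Measurable fun (ζ : B1Eq324BenfattoLemma.Site d → ℝ) (x : B1Eq324BenfattoLemma.Site d) => u x + ζ x :=
  measurable_pi_lambda _ fun x => measurable_const.add (measurable_pi_apply x)

/-- **THE CONDITIONED FIELD IS COVARIANT UNDER RE-INDEXING** — for a positive-semidefinite kernel `K` with `K_{e(C)e(C)}` invertible and an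
injective `e : Q₀ → Q₀`, the law of `(z_{e(x)})_{x∈Q₀}` under `P̄^K_{e(C),w}` is the conditioned field of the re-indexed kernel
`K′ = K(e·, e·)` on `C` with datum `w ∘ e`:  `(P̄^K_{e(C),w}).map (z ↦ z ∘ e) = P̄^{K′}_{C, w∘e}`.  This is what «we can proceed as before
choosing a new pavement displaced by b²/2» (p. 159) needs for the measure `P̄` of p. 152 when the covariance is NOT translation invariant:
the displaced step is the standard step for the transported kernel. [cite: BenfattoEtAl1978, p.152; §5 p.159] -/
theorem condFieldK_map_reindex (hK : IsPosSemidefKernel K) (he : Function.Injective e) (C : Finset (B1Eq324BenfattoLemma.Site d))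
    (hC : IsUnit (covGram K (C.image e)).det) (w : B1Eq324BenfattoLemma.Site d → ℝ) :
    ((gaussianFieldOfKernel (condCov K (C.image e))).map
        (fun (ζ : B1Eq324BenfattoLemma.Site d → ℝ) (y : B1Eq324BenfattoLemma.Site d) => condMean K (C.image e) w y + ζ y)).map
      (fun (z : B1Eq324BenfattoLemma.Site d → ℝ) (x : B1Eq324BenfattoLemma.Site d) => z (e x)) =
    (gaussianFieldOfKernel (condCov (fun x y => K (e x) (e y)) C)).map
      (fun (ζ : B1Eq324BenfattoLemma.Site d → ℝ) (x : B1Eq324BenfattoLemma.Site d) =>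
        condMean (fun x y => K (e x) (e y)) C (fun c => w (e c)) x + ζ x) := by
  have hpsd : IsPosSemidefKernel (condCov K (C.image e)) := isPosSemidefKernel_condCov K hK (C.image e) hC
  rw [Measure.map_map (measurable_reindex e) (measurable_shift _)]
  have hcomp : ((fun (z : B1Eq324BenfattoLemma.Site d → ℝ) (x : B1Eq324BenfattoLemma.Site d) => z (e x)) ∘
      fun (ζ : B1Eq324BenfattoLemma.Site d → ℝ) (y : B1Eq324BenfattoLemma.Site d) => condMean K (C.image e) w y + ζ y) =
      (fun (ζ : B1Eq324BenfattoLemma.Site d → ℝ) (x : B1Eq324BenfattoLemma.Site d) =>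
          condMean (fun x y => K (e x) (e y)) C (fun c => w (e c)) x + ζ x) ∘
        fun (ζ : B1Eq324BenfattoLemma.Site d → ℝ) (x : B1Eq324BenfattoLemma.Site d) => ζ (e x) := by
    funext ζ x
    simp only [Function.comp_apply, condMean_reindex K he C w x]
  rw [hcomp, ← Measure.map_map (measurable_shift _) (measurable_reindex e), gaussianFieldOfKernel_map_reindex hpsd e]
  have hker : (fun i j => condCov K (C.image e) (e i) (e j)) = condCov (fun x y => K (e x) (e y)) C := by
    funext i j
    exact (condCov_reindex K he C i j).symm
  rw [hker]

/-- **Integrals against the conditioned field transform covariantly**: `∫ F(z ∘ e) dP̄^K_{e(C),w} = ∫ F dP̄^{K′}_{C,w∘e}` for measurable `F`.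
[cite: BenfattoEtAl1978, p.152; §5 p.159] -/
theorem integral_condFieldK_comp_reindex (hK : IsPosSemidefKernel K) (he : Function.Injective e) (C : Finset (B1Eq324BenfattoLemma.Site d))
    (hC : IsUnit (covGram K (C.image e)).det) (w : B1Eq324BenfattoLemma.Site d → ℝ)
    {F : (B1Eq324BenfattoLemma.Site d → ℝ) → ℝ} (hF : Measurable F) :
    ∫ z, F (fun x => z (e x)) ∂(gaussianFieldOfKernel (condCov K (C.image e))).map
        (fun (ζ : B1Eq324BenfattoLemma.Site d → ℝ) (y : B1Eq324BenfattoLemma.Site d) => condMean K (C.image e) w y + ζ y) =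
      ∫ z, F z ∂(gaussianFieldOfKernel (condCov (fun x y => K (e x) (e y)) C)).map
        (fun (ζ : B1Eq324BenfattoLemma.Site d → ℝ) (x : B1Eq324BenfattoLemma.Site d) =>
          condMean (fun x y => K (e x) (e y)) C (fun c => w (e c)) x + ζ x) := by
  rw [← condFieldK_map_reindex K hK he C hC w, integral_map (measurable_reindex e).aemeasurable hF.aestronglyMeasurable]

end Field

/-! ## §3  Translations: the displaced pavements of §5 p. 159 for a general kernel -/

section Translate

variable (K : B1Eq324BenfattoLemma.Site d → B1Eq324BenfattoLemma.Site d → ℝ)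

/-- `C^{K(·+s,·+s),C}(x, y) = C^{K,C+s}(x + s, y + s)` — the conditional covariance of the SHIFTED kernel on `C` is that of `K` on the
shifted conditioning set. [cite: BenfattoEtAl1978, Appendix C 2) (C.6) p.164; §5 p.159 «a new pavement displaced by b²/2»] -/
theorem condCov_translate (C : Finset (B1Eq324BenfattoLemma.Site d)) (s x y : B1Eq324BenfattoLemma.Site d) :
    condCov (fun x y => K (x + s) (y + s)) C x y = condCov K (C.image fun x => x + s) (x + s) (y + s) :=
  condCov_reindex K (add_left_injective s) C x y

/-- `u^{K(·+s,·+s)}_C(w(· + s))(x) = u^K_{C+s}(w)(x + s)` — the regression mean of the shifted kernel. [cite: BenfattoEtAl1978, Appendix C 2) (C.7) p.164; §5 p.159] -/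
theorem condMean_translate (C : Finset (B1Eq324BenfattoLemma.Site d)) (s : B1Eq324BenfattoLemma.Site d) (w : B1Eq324BenfattoLemma.Site d → ℝ)
    (x : B1Eq324BenfattoLemma.Site d) :
    condMean (fun x y => K (x + s) (y + s)) C (fun c => w (c + s)) x = condMean K (C.image fun x => x + s) w (x + s) :=
  condMean_reindex K (add_left_injective s) C w x

/-- **THE DISPLACED PAVEMENT FOR A GENERAL KERNEL** — translating the lattice by `s` turns the conditioned field of `K` on `C + s` with datum
`w` into the conditioned field of the SHIFTED kernel `K(· + s, · + s)` on `C` with datum `w(· + s)`: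
`(P̄^K_{C+s,w}).map (z ↦ z(· + s)) = P̄^{K(·+s,·+s)}_{C, w(·+s)}` (`K` positive semidefinite, `K_{(C+s)(C+s)}` invertible).  So the §5 chain
over `d + 1` displaced pavements runs, for a class of kernels closed under lattice shifts, as the standard step for the carried kernel
`K ∘ (+σ_k)`. [cite: BenfattoEtAl1978, p.152; §5 p.159] -/
theorem condFieldK_map_translate (hK : IsPosSemidefKernel K) (C : Finset (B1Eq324BenfattoLemma.Site d)) (s : B1Eq324BenfattoLemma.Site d)
    (hC : IsUnit (covGram K (C.image fun x => x + s)).det) (w : B1Eq324BenfattoLemma.Site d → ℝ) :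
    ((gaussianFieldOfKernel (condCov K (C.image fun x => x + s))).map
        (fun (ζ : B1Eq324BenfattoLemma.Site d → ℝ) (y : B1Eq324BenfattoLemma.Site d) => condMean K (C.image fun x => x + s) w y + ζ y)).map
      (fun (z : B1Eq324BenfattoLemma.Site d → ℝ) (x : B1Eq324BenfattoLemma.Site d) => z (x + s)) =
    (gaussianFieldOfKernel (condCov (fun x y => K (x + s) (y + s)) C)).map
      (fun (ζ : B1Eq324BenfattoLemma.Site d → ℝ) (x : B1Eq324BenfattoLemma.Site d) =>
        condMean (fun x y => K (x + s) (y + s)) C (fun c => w (c + s)) x + ζ x) :=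
  condFieldK_map_reindex K hK (add_left_injective s) C hC w

/-- `∫ F(z(· + s)) dP̄^K_{C+s,w} = ∫ F dP̄^{K(·+s,·+s)}_{C,w(·+s)}` for measurable `F`. [cite: BenfattoEtAl1978, p.152; §5 p.159] -/
theorem integral_condFieldK_comp_translate (hK : IsPosSemidefKernel K) (C : Finset (B1Eq324BenfattoLemma.Site d)) (s : B1Eq324BenfattoLemma.Site d)
    (hC : IsUnit (covGram K (C.image fun x => x + s)).det) (w : B1Eq324BenfattoLemma.Site d → ℝ)
    {F : (B1Eq324BenfattoLemma.Site d → ℝ) → ℝ} (hF : Measurable F) :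
    ∫ z, F (fun x => z (x + s)) ∂(gaussianFieldOfKernel (condCov K (C.image fun x => x + s))).map
        (fun (ζ : B1Eq324BenfattoLemma.Site d → ℝ) (y : B1Eq324BenfattoLemma.Site d) => condMean K (C.image fun x => x + s) w y + ζ y) =
      ∫ z, F z ∂(gaussianFieldOfKernel (condCov (fun x y => K (x + s) (y + s)) C)).map
        (fun (ζ : B1Eq324BenfattoLemma.Site d → ℝ) (x : B1Eq324BenfattoLemma.Site d) =>
          condMean (fun x y => K (x + s) (y + s)) C (fun c => w (c + s)) x + ζ x) :=
  integral_condFieldK_comp_reindex K hK (add_left_injective s) C hC w hF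

/-- For a translation-INVARIANT kernel the Gram determinant on `C + s` is the one on `C`. [cite: BenfattoEtAl1978, (1.1) p.144, Appendix C (C.7) p.164] -/
theorem det_covGram_image_add_of_invariant (C : Finset (B1Eq324BenfattoLemma.Site d)) (s : B1Eq324BenfattoLemma.Site d)
    (hinv : ∀ x y, K (x + s) (y + s) = K x y) :
    (covGram K (C.image fun x => x + s)).det = (covGram K C).det := by
  have hKs : (fun x y => K (x + s) (y + s)) = K := funext fun x => funext fun y => hinv x y
  rw [← det_covGram_reindex K (add_left_injective s) C, hKs]

/-- **TRANSLATION COVARIANCE OF `P̄` FOR AN INVARIANT KERNEL** — if `K(x + s, y + s) = K(x, y)` then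
`(P̄^K_{C+s,w}).map (z ↦ z(· + s)) = P̄^K_{C, w(·+s)}`: the statement shape of the free-field theorem
`…CondTranslation.condField_map_translate`, for every translation-invariant positive-semidefinite kernel with `K_CC` invertible (at
`K = freeCov d α β` that theorem is this one modulo `rfl` on `condField` and `…AppendixC2.isUnit_det_covGram_freeCov`).
[cite: BenfattoEtAl1978, p.152; §5 p.159] -/
theorem condFieldK_map_translate_of_invariant (hK : IsPosSemidefKernel K) (C : Finset (B1Eq324BenfattoLemma.Site d))
    (s : B1Eq324BenfattoLemma.Site d) (hinv : ∀ x y, K (x + s) (y + s) = K x y) (hC : IsUnit (covGram K C).det)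
    (w : B1Eq324BenfattoLemma.Site d → ℝ) :
    ((gaussianFieldOfKernel (condCov K (C.image fun x => x + s))).map
        (fun (ζ : B1Eq324BenfattoLemma.Site d → ℝ) (y : B1Eq324BenfattoLemma.Site d) => condMean K (C.image fun x => x + s) w y + ζ y)).map
      (fun (z : B1Eq324BenfattoLemma.Site d → ℝ) (x : B1Eq324BenfattoLemma.Site d) => z (x + s)) =
    (gaussianFieldOfKernel (condCov K C)).map
      (fun (ζ : B1Eq324BenfattoLemma.Site d → ℝ) (x : B1Eq324BenfattoLemma.Site d) => condMean K C (fun c => w (c + s)) x + ζ x) := by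
  have hKs : (fun x y => K (x + s) (y + s)) = K := funext fun x => funext fun y => hinv x y
  have hC' : IsUnit (covGram K (C.image fun x => x + s)).det := by
    rwa [det_covGram_image_add_of_invariant K C s hinv]
  have h := condFieldK_map_translate K hK C s hC' w
  rwa [hKs] at h

/-- `∫ F(z(· + s)) dP̄^K_{C+s,w} = ∫ F dP̄^K_{C,w(·+s)}` for a translation-invariant kernel and measurable `F` — the statement shape of the
free-field `…CondTranslation.integral_condField_comp_translate`. [cite: BenfattoEtAl1978, p.152; §5 p.159] -/
theorem integral_condFieldK_comp_translate_of_invariant (hK : IsPosSemidefKernel K) (C : Finset (B1Eq324BenfattoLemma.Site d))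
    (s : B1Eq324BenfattoLemma.Site d) (hinv : ∀ x y, K (x + s) (y + s) = K x y) (hC : IsUnit (covGram K C).det)
    (w : B1Eq324BenfattoLemma.Site d → ℝ) {F : (B1Eq324BenfattoLemma.Site d → ℝ) → ℝ} (hF : Measurable F) :
    ∫ z, F (fun x => z (x + s)) ∂(gaussianFieldOfKernel (condCov K (C.image fun x => x + s))).map
        (fun (ζ : B1Eq324BenfattoLemma.Site d → ℝ) (y : B1Eq324BenfattoLemma.Site d) => condMean K (C.image fun x => x + s) w y + ζ y) =
      ∫ z, F z ∂(gaussianFieldOfKernel (condCov K C)).map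
        (fun (ζ : B1Eq324BenfattoLemma.Site d → ℝ) (x : B1Eq324BenfattoLemma.Site d) => condMean K C (fun c => w (c + s)) x + ζ x) := by
  rw [← condFieldK_map_translate_of_invariant K hK C s hinv hC w,
    integral_map (measurable_reindex fun x => x + s).aemeasurable hF.aestronglyMeasurable]

end Translate

end Literature.MathematicalPhysics.QuantumFieldTheory.Balaban1983to89.B1Eq324BenfattoKernelCondTranslation

end
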